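import Literature.Analysis.Fourier.GradientBoundAnnular
import Literature.Analysis.Fourier.LocalizedPhaseFamilies
import Literature.Barriers.AtomisticToContinuum.NoBVEstimatesMultiDLinearStepProofs
import Literature.Barriers.AtomisticToContinuum.NoBVEstimatesMultiDLinearStepAssembly
import Literature.Analysis.Fourier.GradientBoundInterpolation
import Literature.Analysis.Fourier.GradientBoundLpMultiplier
import HarnessLib

/-!
# Rauch's linear step at `p = 1`: the `L¹` gradient estimate (5) forces the commutation
relations (3) WITHOUT interpolation and WITHOUT the Riesz transforms

The printed route [Rauch1986, Proof of Theorem p. 483] from the `L¹` gradient estimate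
(5) `‖∇ₓv(t̄)‖_{L¹} ≤ c‖∇ₓφ‖_{L¹}` for the constant-coefficient system `A₀∂ₜv + Σ Aⱼ∂ⱼv = 0` to
the commutation relations (3) runs: "Interpolating, (5) is valid for `Lᵖ`, `1 < p < 2`" —
"`Dⱼ/|D|` is a bounded operator on `Lᵖ`" — "`M(D)` is itself bounded" — "the result of Brenner
[1, 2]". In the tree this is `linearL1EstimateForcesCommutation_zero_of`
(`NoBVEstimatesMultiDLinearStepAssembly.lean`), relative to the named facts
`gradientLpBound_interpolation`, `isLpMultiplier_of_gradientLpBound`,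
`Rauch1986_LpMultiplier_forces_commutation` — all three now PROVED in the tree
(`GradientBoundInterpolation.lean`, `GradientBoundLpMultiplier.lean`,
`NoBVEstimatesMultiDLinearStepProofs.lean`) — and finite speed of propagation
(`Rauch1986_finitePropagationSpeed`); the unconditional form of that route is recorded below as
`linearL1EstimateForcesCommutation_zero_of_finitePropagationSpeed'`.

This file also PROVES the same linear step by a second, shorter road that stays at the endpoint
`p = 1` and uses neither the interpolation of homogeneous Sobolev spaces nor the Riesz
transforms:

1. (5) is the homogeneous Sobolev bound `HasGradientLpBoundWith 1 (2dc) M_T` for Rauch's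
   multiplier `M_T = rauchSymbol A₀ A 0 T` (`hasGradientLpBoundWith_one_rauchSymbol`, tree);
2. hence, elementarily, `η(ξ/t)M_T(ξ) ∈ M₁` with ONE constant for all `t > 0`, for every
   smooth `η` supported in an annulus (`HasGradientLpBoundWith.isLpMultiplierWith_annular`,
   `GradientBoundAnnular.lean`);
3. by dilation (`M_T((n+1)ξ) = exp(-i(n+1)K(ξ))`, `K_l = 2πTA₀⁻¹A_l`, `rauchSymbol_smul`) this is
   a LOCALLY uniform `L¹` multiplier family of phase symbols near every `ξ⁰ ≠ 0`
   (`locallyUniformExpFamily_of_hasGradientLpBoundWith_one`);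
4. Brenner–Thomée–Wahlbin's Lemma 1.1 is printed for `1 ≤ p ≤ ∞`, `p ≠ 2` — in particular
   `p = 1` — and its proof only uses the family through a cut-off near a point `ξ⁰ ≠ 0`
   [BrennerThomeeWahlbin1975, Ch. 5 §1 (1.5)]; the tree's formalisation has this form
   (`hasLinearEigenvalues_of_locallyUniformExpFamily`,
   `not_locallyUniformExpFamily_of_strictlyHyperbolic`, `LocalizedPhaseFamilies.lean`), so the two
   branches of Rauch's class conclude exactly as in `Rauch1986_LpMultiplier_forces_commutation_holds`
   with `p := 1` (`commute_of_locallyUniformExpFamily_rauchPencil`).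

Consequences (`linearL1EstimateForcesCommutation_zero_of_finitePropagationSpeed`,
`jacobiansCommuteAt_of_hasSmallDataBVEstimate_of_fderiv_B_eq_zero_of_facts`): the `B₁ = 0` linear
step rests on finite speed of propagation alone, and Rauch's theorem for every system with
`B′(ū) = 0` (all systems of conservation laws without source, e.g. compressible Euler) rests on
TWO named facts only — the `L²` small-amplitude expansion `Rauch1986_smallAmplitudeExpansionL2`
and finite speed of propagation `Rauch1986_finitePropagationSpeed` (whose symmetrizable branch,
`k ≤ 2` and `d ≤ 1` are proved).

## References

* [Rauch1986] J. Rauch, Comm. Math. Phys. 106 (1986) 481–484, Theorem p. 482 and Proof of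
  Theorem pp. 482–483, (5)–(6).
* [BrennerThomeeWahlbin1975] P. Brenner, V. Thomée, L. B. Wahlbin, LNM 434 (1975), Ch. 1
  Thms 2.3, 2.8; Ch. 5 §1 Thm 1.1, Lemma 1.1 (stated for `1 ≤ p ≤ ∞`, `p ≠ 2`) with its proof
  (1.4)–(1.5), Lemma 1.2.
* [Brenner1973] P. Brenner, Ark. Mat. 11 (1973) 75–101, Thm 3.1 and Cor 3.1 p. 84.
-/

noncomputable section

open MeasureTheory Complex Real Filter Topology Set Metric Matrix
open scoped ENNReal NNReal ContDiff

namespace Literature.Barriers.AtomisticToContinuum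

open Literature.Analysis.Fourier Literature.Analysis.Matrix Literature.LinearAlgebra.Matrix
  QuasilinearSystem

variable {d k : ℕ}

/-! ### Conjugating a locally uniform family by a constant matrix -/

/-- Constant conjugation preserves locally uniform phase families of a real pencil (the cut-off
is scalar, so it commutes with the conjugation; constants change by `‖R‖‖R⁻¹‖`).
[cite: BrennerThomeeWahlbin1975, Ch. 5 §1 (1.3)] -/
theorem locallyUniformExpFamily_rauch_conj {p : ℝ≥0∞} {K : Fin d → Matrix (Fin k) (Fin k) ℝ}
    (h : LocallyUniformExpFamily p (fun j => (-K j).map (algebraMap ℝ ℂ)) 1)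
    (R : Matrix (Fin k) (Fin k) ℝ) (hR : IsUnit R.det) :
    LocallyUniformExpFamily p (fun j => (-(R⁻¹ * K j * R)).map (algebraMap ℝ ℂ)) 1 := by
  intro ξ₀ hξ₀
  obtain ⟨ρ, hρ, η, C, hη1, hN⟩ := h ξ₀ hξ₀
  refine ⟨ρ, hρ, η, ‖LinearMap.toContinuousLinearMap (Matrix.mulVecLin ((R⁻¹).map (algebraMap ℝ ℂ)))‖₊ *
    C * ‖LinearMap.toContinuousLinearMap (Matrix.mulVecLin (R.map (algebraMap ℝ ℂ)))‖₊, hη1,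
    fun n => ?_⟩
  have h1 := ((hN n).const_mul ((R⁻¹).map (algebraMap ℝ ℂ))).mul_const (R.map (algebraMap ℝ ℂ))
  have heq : (fun ξ : EuclideanSpace ℝ (Fin d) => (R⁻¹).map (algebraMap ℝ ℂ) *
      (η ξ • NormedSpace.exp ((((((n : ℝ) + 1) * 1 : ℝ) : ℂ) * I) •
        pencil (fun j => (-K j).map (algebraMap ℝ ℂ)) ξ)) * R.map (algebraMap ℝ ℂ)) =
      fun ξ => η ξ • NormedSpace.exp ((((((n : ℝ) + 1) * 1 : ℝ) : ℂ) * I) •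
        pencil (fun j => (-(R⁻¹ * K j * R)).map (algebraMap ℝ ℂ)) ξ) := by
    funext ξ
    rw [Matrix.mul_smul, Matrix.smul_mul, ← rauchPhaseSymbol_zero_eq_exp_pencil K,
      ← rauchPhaseSymbol_zero_eq_exp_pencil (fun l => R⁻¹ * K l * R)]
    have hc := rauchPhaseSymbol_conj K 0 R hR ((n : ℝ) + 1) ξ
    rw [Matrix.mul_zero, Matrix.zero_mul] at hc
    rw [hc]
  rwa [heq] at h1

/-! ### The localized `L¹` family from the `L¹` gradient bound -/

/-- The rescaled cut-off `ζ ↦ θ(‖ξ⁰‖ζ)` of a bump `θ` at `ξ⁰ ≠ 0` with outer radius `‖ξ⁰‖/4` is an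
annular cut-off (supported in `3/4 < ‖ζ‖ < 5/4`). [folklore] -/
theorem isAnnularCutoff_bump_comp_smul {ξ₀ : EuclideanSpace ℝ (Fin d)} (hξ₀ : ξ₀ ≠ 0)
    (θ : ContDiffBump ξ₀) (hθ : θ.rOut = ‖ξ₀‖ / 4) :
    IsAnnularCutoff (fun ζ : EuclideanSpace ℝ (Fin d) => ((θ (‖ξ₀‖ • ζ) : ℝ) : ℂ)) := by
  have hr : 0 < ‖ξ₀‖ := norm_pos_iff.2 hξ₀
  refine ⟨ofRealCLM.contDiff.comp (θ.contDiff.comp (contDiff_const_smul _)), fun ζ hζ => ?_⟩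
  have hζ' : (θ (‖ξ₀‖ • ζ) : ℝ) ≠ 0 := fun h0 => hζ (by rw [h0, Complex.ofReal_zero])
  have hmem : ‖ξ₀‖ • ζ ∈ ball ξ₀ θ.rOut := by
    have : ‖ξ₀‖ • ζ ∈ Function.support (θ : EuclideanSpace ℝ (Fin d) → ℝ) := hζ'
    rwa [θ.support_eq] at this
  rw [mem_ball, hθ, dist_eq_norm] at hmem
  have h1 : ‖ξ₀‖ * ‖ζ‖ = ‖‖ξ₀‖ • ζ‖ := by rw [norm_smul, Real.norm_of_nonneg hr.le]
  have hup : ‖‖ξ₀‖ • ζ‖ < ‖ξ₀‖ + ‖ξ₀‖ / 4 := by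
    calc ‖‖ξ₀‖ • ζ‖ = ‖(‖ξ₀‖ • ζ - ξ₀) + ξ₀‖ := by rw [sub_add_cancel]
      _ ≤ ‖‖ξ₀‖ • ζ - ξ₀‖ + ‖ξ₀‖ := norm_add_le _ _
      _ < ‖ξ₀‖ / 4 + ‖ξ₀‖ := by linarith
      _ = ‖ξ₀‖ + ‖ξ₀‖ / 4 := by ring
  have hlow : ‖ξ₀‖ - ‖ξ₀‖ / 4 < ‖‖ξ₀‖ • ζ‖ := by
    have := norm_sub_norm_le ξ₀ (‖ξ₀‖ • ζ)
    rw [← norm_neg (ξ₀ - ‖ξ₀‖ • ζ), neg_sub] at this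
    linarith
  rw [← h1] at hup hlow
  constructor
  · nlinarith
  · nlinarith

/-- **The locally uniform `L¹` family of Rauch's phase symbols from the `L¹` gradient bound.**
If Rauch's multiplier `M_T = rauchSymbol A₀ A 0 T` is bounded and has the `Ẇ^{1,1}` bound
`HasGradientLpBoundWith 1 c M_T` (Rauch's (5)), then near every `ξ⁰ ≠ 0` the cut-off dilates
`η M_T((n+1)·) = η exp(i(n+1)·pencil(-K))`, `K_l = 2πTA₀⁻¹A_l`, form an `L¹` multiplier family
with one constant: annular `L¹` bounds (`HasGradientLpBoundWith.isLpMultiplierWith_annular` with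
`t = ‖ξ⁰‖(n+1)`) and dilation invariance of `M₁`.
[cite: Rauch1986, Proof of Theorem p. 483, (5)–(6); BrennerThomeeWahlbin1975, Ch. 1 Thm 2.8] -/
theorem locallyUniformExpFamily_of_hasGradientLpBoundWith_one
    {A₀ : Matrix (Fin k) (Fin k) ℝ} {A : Fin d → Matrix (Fin k) (Fin k) ℝ} {T : ℝ} {c : ℝ≥0}
    (hG : HasGradientLpBoundWith 1 c (rauchSymbol A₀ A 0 T))
    {C₀ : ℝ≥0} (hC : ∀ (ξ : Space d) (a b : Fin k), ‖rauchSymbol A₀ A 0 T ξ a b‖ ≤ C₀) :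
    LocallyUniformExpFamily 1 (fun j => (-(rauchPencil A₀ A T j)).map (algebraMap ℝ ℂ)) 1 := by
  intro ξ₀ hξ₀
  have hr : 0 < ‖ξ₀‖ := norm_pos_iff.2 hξ₀
  set θ : ContDiffBump ξ₀ := ⟨‖ξ₀‖ / 8, ‖ξ₀‖ / 4, by positivity, by linarith⟩ with hθdef
  set η : EuclideanSpace ℝ (Fin d) → ℂ := fun ζ => ((θ (‖ξ₀‖ • ζ) : ℝ) : ℂ) with hηdef
  have hη : IsAnnularCutoff η := isAnnularCutoff_bump_comp_smul hξ₀ θ rfl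
  have hM := measurable_rauchSymbol_apply A₀ A 0 T
  refine ⟨‖ξ₀‖ / 8, by positivity, fun ξ => ((θ ξ : ℝ) : ℂ), c * annularConst d * hη.const,
    fun ξ hξ => ?_, fun n => ?_⟩
  · show ((θ ξ : ℝ) : ℂ) = 1
    rw [θ.one_of_mem_closedBall (ball_subset_closedBall hξ), Complex.ofReal_one]
  · have hn : (0 : ℝ) < (n : ℝ) + 1 := by positivity
    have ht : ‖ξ₀‖ * ((n : ℝ) + 1) ≠ 0 := by positivity
    have h1 := (hG.isLpMultiplierWith_annular hM hC le_rfl ENNReal.one_ne_top hη ht).comp_smul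
      (c := (n : ℝ) + 1) hn.ne'
    have heq : (fun ξ : EuclideanSpace ℝ (Fin d) =>
        η ((‖ξ₀‖ * ((n : ℝ) + 1))⁻¹ • (((n : ℝ) + 1) • ξ)) • rauchSymbol A₀ A 0 T (((n : ℝ) + 1) • ξ)) =
        fun ξ => ((θ ξ : ℝ) : ℂ) • NormedSpace.exp ((((((n : ℝ) + 1) * 1 : ℝ) : ℂ) * I) •
          pencil (fun j => (-(rauchPencil A₀ A T j)).map (algebraMap ℝ ℂ)) ξ) := by
      funext ξ
      rw [rauchSymbol_smul, rauchZeroth_zero, rauchPhaseSymbol_zero_eq_exp_pencil, hηdef]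
      dsimp only
      rw [smul_smul, smul_smul]
      have h1 : ‖ξ₀‖ * (‖ξ₀‖ * ((n : ℝ) + 1))⁻¹ * ((n : ℝ) + 1) = 1 := by field_simp
      rw [h1, one_smul]
    rwa [heq] at h1

/-! ### Both branches of Rauch's class, at `p = 1` -/

/-- **A locally uniform phase family (any `1 ≤ p`, `p ≠ 2`) for the pencil of a constant-coefficient
system in Rauch's class at `0` forces the `A₀⁻¹Aⱼ` to commute** — the two branches as in
`Rauch1986_LpMultiplier_forces_commutation_holds`: symmetrizable ⟹ conjugate to a symmetric pencil,
Lemma 1.1 (local form) and Lemma 1.2; strictly hyperbolic with `d, k ≥ 2` ⟹ contradiction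
(Brenner's Thm 3.1, local form); `d ≤ 1` or `k ≤ 1` trivial [Rauch1986, Examples 1–2].
[cite: Rauch1986, Proof of Theorem p. 483 (last sentence) and Examples 1–2 p. 482;
BrennerThomeeWahlbin1975, Ch. 5 §1 Thm 1.1, Lemmas 1.1–1.2; Brenner1973, Cor 3.1 p. 84] -/
theorem commute_of_locallyUniformExpFamily_rauchPencil {p : ℝ≥0∞} (hp1 : 1 ≤ p) (hp2 : p ≠ 2)
    {A₀ : Matrix (Fin k) (Fin k) ℝ} {A : Fin d → Matrix (Fin k) (Fin k) ℝ}
    (hS : (ofConstant A₀ A 0).IsRauchClass 0) {T : ℝ} (hT : 0 < T)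
    (hfam : LocallyUniformExpFamily p (fun j => (-(rauchPencil A₀ A T j)).map (algebraMap ℝ ℂ)) 1)
    (j l : Fin d) : Commute (A₀⁻¹ * A j) (A₀⁻¹ * A l) := by
  obtain ⟨U, hU, hcases⟩ := hS.hyperbolic
  have h0U : (0 : Fin k → ℝ) ∈ U := mem_of_mem_nhds hU
  rcases hcases with ⟨Sym, -, hSym⟩ | hst
  · -- symmetrizable branch
    obtain ⟨hpos, hsymm⟩ := hSym 0 h0U
    simp only [ofConstant_A0, ofConstant_A] at hpos hsymm
    obtain ⟨R, hR, K', hK', hconj⟩ := exists_conj_isSymm_rauchPencil A₀ A (Sym 0) hpos hsymm T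
    have hR' : IsUnit (R⁻¹).det := Matrix.isUnit_nonsing_inv_det R hR
    -- the family for `K'`: conjugate by `R⁻¹`
    have hfam' : LocallyUniformExpFamily p (fun j => (-K' j).map (algebraMap ℝ ℂ)) 1 := by
      have h1 := locallyUniformExpFamily_rauch_conj hfam (R⁻¹) hR'
      have hK'eq : (fun l => (R⁻¹)⁻¹ * rauchPencil A₀ A T l * R⁻¹) = K' := by
        funext l
        rw [hconj l, Matrix.nonsing_inv_nonsing_inv R hR]
        have hRR' : R * R⁻¹ = 1 := Matrix.mul_nonsing_inv _ hR
        calc R * (R⁻¹ * K' l * R) * R⁻¹ = (R * R⁻¹) * K' l * (R * R⁻¹) := by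
              simp only [Matrix.mul_assoc]
          _ = K' l := by rw [hRR', Matrix.one_mul, Matrix.mul_one]
      have hAeq : (fun j => (-((R⁻¹)⁻¹ * rauchPencil A₀ A T j * R⁻¹)).map (algebraMap ℝ ℂ)) =
          fun j => (-K' j).map (algebraMap ℝ ℂ) := by
        funext j
        rw [← hK'eq]
      rwa [hAeq] at h1
    set A' : Fin d → Matrix (Fin k) (Fin k) ℂ := fun j => (-K' j).map (algebraMap ℝ ℂ) with hA'
    have hAh : ∀ j, (A' j).IsHermitian := fun j => isHermitian_map_of_isSymm (hK' j).neg
    have hlin : HasLinearEigenvalues A' :=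
      hasLinearEigenvalues_of_locallyUniformExpFamily hAh hp1 hp2 (s := 1) one_ne_zero hfam'
    have hcomm : Commute (A' j) (A' l) := hlin.commute hAh j l
    have hreal : Commute (-K' j) (-K' l) := commute_of_commute_map hcomm
    have hK'c : Commute (K' j) (K' l) := Commute.neg_left_iff.1 (Commute.neg_right_iff.1 hreal)
    have hpen : Commute (rauchPencil A₀ A T j) (rauchPencil A₀ A T l) := by
      rw [hconj j, hconj l]
      exact commute_conj hR hK'c
    exact commute_of_commute_rauchPencil hT.ne' hpen
  · -- strictly hyperbolic branch
    obtain ⟨-, hstrict⟩ := hst 0 h0U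
    rcases Nat.lt_or_ge d 2 with hd | hd
    · have : Subsingleton (Fin d) := Fin.subsingleton_iff_le_one.2 (by omega)
      rw [Subsingleton.elim j l]
    rcases Nat.lt_or_ge k 2 with hk | hk
    · exact commute_of_le_one (by omega) _ _
    · -- the pencil `-K`, `K = rauchPencil`, is strictly hyperbolic and carries the family
      have hK := isStrictlyHyperbolicPencil_rauchPencil hstrict hT.ne'
      have hK'h : IsStrictlyHyperbolicPencil (fun j => -rauchPencil A₀ A T j) := by
        have h1 := IsStrictlyHyperbolicPencil.smul (K := rauchPencil A₀ A T) hK (c := -1) (by norm_num)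
        have heq : (fun j => (-1 : ℝ) • rauchPencil A₀ A T j) = fun j => -rauchPencil A₀ A T j :=
          funext fun j => by rw [neg_one_smul]
        rwa [heq] at h1
      exact (not_locallyUniformExpFamily_of_strictlyHyperbolic hp1 hp2 hK'h hd hk hfam).elim

/-! ### The linear step at `p = 1` and Rauch's theorem for `B′(ū) = 0` -/

/-- **Rauch's linear step without zeroth-order term, from finite speed of propagation alone.**
For a constant-coefficient system `A₀∂ₜv + Σ Aⱼ∂ⱼv = 0` in Rauch's class at `0` and `T > 0`: if
every `φ ∈ C_c^∞(ℝᵈ; ℝᵏ)` is the datum of a classical solution `v` on `[0, T]` with `v(T)`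
compactly supported and `∫‖∇ₓv(T)‖ ≤ c∫‖∇ₓφ‖` (Rauch's (5)), then the `A₀⁻¹Aⱼ` commute
(Rauch's (3)). The proof stays at `p = 1` (module docstring): no interpolation, no Riesz
transforms. Finite speed of propagation (`Rauch1986_finitePropagationSpeed`, for the
constant-coefficient system) is used to identify `v(T)` with `M_T(D)φ`.
[cite: Rauch1986, Proof of Theorem p. 483, (5)–(6) and last sentence;
BrennerThomeeWahlbin1975, Ch. 5 §1 Lemma 1.1; Brenner1973, Cor 3.1 p. 84] -/
theorem linearL1EstimateForcesCommutation_zero_of_finitePropagationSpeed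
    (hF : Rauch1986_finitePropagationSpeed) ⦃d k : ℕ⦄
    (A₀ : Matrix (Fin k) (Fin k) ℝ) (A : Fin d → Matrix (Fin k) (Fin k) ℝ)
    (hS : (ofConstant A₀ A 0).IsRauchClass 0) (c T : ℝ) (hc : 0 < c) (hT : 0 < T)
    (hyp : ∀ φ : Space d → Fin k → ℝ, ContDiff ℝ ∞ φ → HasCompactSupport φ →
      ∃ v : ℝ → Space d → Fin k → ℝ,
        (ofConstant A₀ A 0).IsClassicalSolution T v ∧ (∀ x, v 0 x = φ x) ∧
        HasCompactSupport (v T) ∧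
        ∫ x, ‖fderiv ℝ (v T) x‖ ≤ c * ∫ x, ‖fderiv ℝ φ x‖)
    (j l : Fin d) : Commute (A₀⁻¹ * A j) (A₀⁻¹ * A l) := by
  obtain ⟨hdet, -⟩ := exists_continuous_symmetrizer_family hS
  obtain ⟨cₚ, hcₚ, hps⟩ := hF (ofConstant A₀ A 0) 0 hS
  obtain ⟨C₀, hC₀⟩ := exists_nnreal_bound_rauchSymbol hS T
  have hG := hasGradientLpBoundWith_one_rauchSymbol hS hdet hcₚ hps hT.le hc.le hyp
  have hfam := locallyUniformExpFamily_of_hasGradientLpBoundWith_one hG hC₀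
  exact commute_of_locallyUniformExpFamily_rauchPencil le_rfl (by norm_num) hS hT hfam j l

/-- The same linear step by the printed `Lᵖ` route (`1 < p < 2`), now that its three named
inputs are proved in the tree: `linearL1EstimateForcesCommutation_zero_of` fed with
`gradientLpBound_interpolation_holds`, `isLpMultiplier_of_gradientLpBound_holds` and
`Rauch1986_LpMultiplier_forces_commutation_holds`.
[cite: Rauch1986, Proof of Theorem p. 483; Brenner1973, Cor 3.1 p. 84] -/
theorem linearL1EstimateForcesCommutation_zero_of_finitePropagationSpeed'
    (hF : Rauch1986_finitePropagationSpeed) ⦃d k : ℕ⦄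
    (A₀ : Matrix (Fin k) (Fin k) ℝ) (A : Fin d → Matrix (Fin k) (Fin k) ℝ)
    (hS : (ofConstant A₀ A 0).IsRauchClass 0) (c T : ℝ) (hc : 0 < c) (hT : 0 < T)
    (hyp : ∀ φ : Space d → Fin k → ℝ, ContDiff ℝ ∞ φ → HasCompactSupport φ →
      ∃ v : ℝ → Space d → Fin k → ℝ,
        (ofConstant A₀ A 0).IsClassicalSolution T v ∧ (∀ x, v 0 x = φ x) ∧
        HasCompactSupport (v T) ∧
        ∫ x, ‖fderiv ℝ (v T) x‖ ≤ c * ∫ x, ‖fderiv ℝ φ x‖)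
    (j l : Fin d) : Commute (A₀⁻¹ * A j) (A₀⁻¹ * A l) :=
  linearL1EstimateForcesCommutation_zero_of gradientLpBound_interpolation_holds
    isLpMultiplier_of_gradientLpBound_holds hF Rauch1986_LpMultiplier_forces_commutation_holds
    A₀ A hS c T hc hT hyp j l

/-- **Rauch's theorem for systems with `B′(ū) = 0` (every system of conservation laws without
source term, in particular the compressible Euler equations of the barrier's `blocks`) relative to
the TWO residual named facts of its cone**: the `L²` small-amplitude expansion
(`Rauch1986_smallAmplitudeExpansionL2`) and finite speed of propagation
(`Rauch1986_finitePropagationSpeed`): the small-data `BV` estimate (2) at `ū` forces the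
commutation relations (3). The proof is that of
`jacobiansCommuteAt_of_hasSmallDataBVEstimate_of_fderiv_B_eq_zero` with the linear step taken
from `linearL1EstimateForcesCommutation_zero_of_finitePropagationSpeed`.
[cite: Rauch1986, Theorem p. 482 and Proof of Theorem pp. 482–483] -/
theorem jacobiansCommuteAt_of_hasSmallDataBVEstimate_of_fderiv_B_eq_zero_of_facts
    (hE : Rauch1986_smallAmplitudeExpansionL2) (hF : Rauch1986_finitePropagationSpeed)
    {S : QuasilinearSystem d k} {ubar : Fin k → ℝ} {s : ℕ} (hS : S.IsRauchClass ubar)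
    (hB0 : fderiv ℝ S.B ubar = 0) (hBV : S.HasSmallDataBVEstimate ubar s) :
    S.JacobiansCommuteAt ubar := by
  have h₁ : Rauch1986_smallAmplitudeExpansion := Rauch1986_smallAmplitudeExpansion_of_facts hE hF
  have hlin : S.linearization ubar = ofConstant (S.A0 ubar) (fun j => S.A j ubar) 0 := by
    rw [linearization, hB0]
  have hS0 : (ofConstant (S.A0 ubar) (fun j => S.A j ubar) 0).IsRauchClass 0 := by
    rw [← hlin]; exact hS.linearization
  obtain ⟨c, T, η, hT, hη, hest⟩ := hBV
  intro j l
  refine linearL1EstimateForcesCommutation_zero_of_finitePropagationSpeed hF (S.A0 ubar)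
    (fun j => S.A j ubar) hS0 (max c 1) T (lt_max_of_lt_right one_pos) hT ?_ j l
  intro φ hφ hφc
  obtain ⟨v, hv, hv0, hvT, u, C, hev⟩ := h₁ S ubar hS hT φ hφ hφc
  rw [hlin] at hv
  refine ⟨v, hv, hv0, hvT, ?_⟩
  -- `‖εφ‖²_{Hˢ} = ε²‖φ‖²_{Hˢ} < η²` for small `ε`
  have hsmall : ∀ᶠ ε in 𝓝[>] (0 : ℝ), hsNormSq s (ε • φ) < η ^ 2 := by
    have ht : Tendsto (fun ε : ℝ => ε ^ 2 * hsNormSq s φ) (𝓝 0) (𝓝 0) := by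
      have := ((continuous_pow 2).mul continuous_const).tendsto (0 : ℝ)
        (f := fun ε : ℝ => ε ^ 2 * hsNormSq s φ)
      simpa using this
    have h2 : ∀ᶠ ε in 𝓝 (0 : ℝ), ε ^ 2 * hsNormSq s φ < η ^ 2 :=
      ht.eventually_lt_const (by positivity)
    filter_upwards [h2.filter_mono (nhdsWithin_le_nhds (s := Ioi (0 : ℝ)))] with ε hε
    rwa [hsNormSq_const_smul hφ]
  have hpos : ∀ᶠ ε in 𝓝[>] (0 : ℝ), 0 < ε := eventually_mem_nhdsWithin
  have hP : ∀ {ε : ℝ}, 0 < ε → ∫ x, ‖fderiv ℝ (ε • φ) x‖ = ε * ∫ x, ‖fderiv ℝ φ x‖ := by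
    intro ε hε
    rw [← integral_const_mul]
    refine integral_congr_ae (Eventually.of_forall fun x => ?_)
    have hdx : DifferentiableAt ℝ φ x := (hφ.differentiable (by simp)).differentiableAt
    simp only
    rw [fderiv_const_smul hdx ε, norm_smul, Real.norm_eq_abs, abs_of_pos hε]
  have hiv : Integrable (fderiv ℝ (v T)) :=
    integrable_fderiv_of_hasCompactSupport (hv.contDiff_slice ⟨hT.le, le_rfl⟩) hvT
  refine integral_norm_le_of_expansion (g := fun ε => fderiv ℝ (u ε T)) (C := C) hiv ?_
  filter_upwards [hev, hsmall, hpos] with ε ⟨hsol, hdata, hsupp, hrem⟩ hεs hε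
  refine ⟨?_, ?_, hrem⟩
  · rw [fderiv_eq_fderiv_sub_const (u ε T) ubar]
    exact integrable_fderiv_of_hasCompactSupport
      ((hsol.contDiff_slice ⟨hT.le, le_rfl⟩).sub contDiff_const) hsupp
  · have hBVε := hest (ε • φ) (hφ.const_smul ε)
      (hφc.mono (Function.support_const_smul_subset ε φ)) hεs (u ε) hsol
      (fun x => by rw [hdata x, Pi.smul_apply])
    rw [hP hε] at hBVε
    exact hBVε.trans (mul_le_mul_of_nonneg_right (le_max_left c 1)
      (mul_nonneg hε.le (integral_nonneg fun _ => norm_nonneg _)))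

/-- **Status of the barrier for conservation laws after this file**: for systems with
`B′(ū) = 0` in Rauch's class, the failure of small-data `BV` estimates at every `ū` where the
`A₀⁻¹Aⱼ` do not commute (Rauch's theorem) is CONDITIONAL ONLY on
`Rauch1986_smallAmplitudeExpansionL2` (the `Hˢ` local existence theory with second-order
expansion in the data) and `Rauch1986_finitePropagationSpeed` (open for strictly hyperbolic
systems with `d ≥ 2`, `k ≥ 3` only). [cite: Rauch1986, Theorem p. 482] -/
theorem not_hasSmallDataBVEstimate_of_not_jacobiansCommuteAt_of_facts
    (hE : Rauch1986_smallAmplitudeExpansionL2) (hF : Rauch1986_finitePropagationSpeed)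
    {S : QuasilinearSystem d k} {ubar : Fin k → ℝ} (hS : S.IsRauchClass ubar)
    (hB0 : fderiv ℝ S.B ubar = 0) (hnc : ¬ S.JacobiansCommuteAt ubar) (s : ℕ) :
    ¬ S.HasSmallDataBVEstimate ubar s := fun hBV =>
  hnc (jacobiansCommuteAt_of_hasSmallDataBVEstimate_of_fderiv_B_eq_zero_of_facts hE hF hS hB0 hBV)

end Literature.Barriers.AtomisticToContinuum

end
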